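import Literature.NumberTheory.EllipticCurves.SkinnerUrban2014.CharacteristicIdealBaseChangeNormalProofs
import HarnessLib

/-!
# X11b, STEP L at `p ‖ N`: the «Σ-removal FIRST, then μ of the PRIMITIVE `L`» ordering
# (Fouquet–Wan 2021, App. B, proof of Thm. 7.32, last paragraph; Wan 2015, Lemma 87 / Thm. 101)
# — pure commutative algebra

HONEST FRAMING (cell `bsd-stepL`, run/shared/lean/pub/bsd-stepL/, seat `bsd-stepL-bdp`, memo
`HOME/proof/PROOF-BDP.md` §19.3/§19.7 and `HOME/bdp/Q-SU3-bdp.md`, query Q-SU3 of TARGET v1.10/v1.11):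
on ROAD HF the Eisenstein-congruence machine (Wan 2020 Lemma 8.1 / Prop. 8.2) yields the divisibility
`ord_P(char X^Σ) ≥ ord_P(𝓛^Σ)` for the Σ-DEPLETED objects only at the height-one primes `P` NOT in an
exceptional set Pb (the primes pulled back from `𝕀⟦Γ⁺⟧`); Wan 2020 §6.4 disposes of Pb by the
sentence «As in [SU] the μ-invariant of the Σ-primitive p-adic L-function is 0 as well», which is
false as printed whenever a removed nonsplit Euler factor is a non-unit (at a ramified non-split
Steinberg prime `q`: `(q+1)/q`, a non-unit iff `q ≡ −1 (mod p)`). The REPAIR printed by the same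
author (Fouquet–Wan 2021 App. B, proof of Thm. 7.32, last paragraph) REORDERS: first put back the
Euler factors on BOTH sides at the primes outside Pb ([Greenberg–Vatsal 2000]: `char X^Σ =
char X · (E)`, `𝓛^Σ = 𝓛 · E` with the SAME `E`), then use `μ = 0` of the PRIMITIVE anticyclotomic
`L`-function (Hsieh 2014 Thm. B) only to see that `𝓛` lies in NO prime of Pb. THIS FILE proves the
abstract bookkeeping of that reordering over a Noetherian normal domain (one theorem): nothing about
Selmer groups, `p`-adic `L`-functions, [GV] or Hsieh's theorem is asserted — they are the labelled
hypotheses `hGV`, `hDiv`, `hμ`. No `sorry`, no definition, no named fact; banked like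
`X11b/IMCCongruenceTransferKrull.lean` (p396597) and `X11b/IMCFamilySpecializationOneSided.lean`
(p398595); no grade word of TARGET.md depends on it.

References: [FouquetWan2021] O. Fouquet, X. Wan, arXiv:2107.13726v3, App. B, Thm. 7.32 and its proof
(last paragraph); [Wan2015HilbertIMC] X. Wan, Forum Math. Sigma 3 (2015) e18, Lemma 87, Thm. 101;
[Wan2020] X. Wan, Algebra Number Theory 14 (2020), §6.4 and §8; [GreenbergVatsal2000] Prop. 2.4;
[SkinnerUrban2014] §3.1.6 (divisorial characteristic ideals); [Matsumura1987] Thm. 11.5.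
-/

noncomputable section

open Literature.RingTheory.FittingIdeal Literature.NumberTheory.EllipticCurves
  Literature.NumberTheory.EllipticCurves.Module Literature.NumberTheory.EllipticCurves.SkinnerUrban2014
  Literature.RingTheory.IntegralClosure

namespace Summit.BirchSwinnertonDyer.Rank1Residual.X11b.ImprimitiveReordering

universe u v w

variable {R : Type u} [CommRing R] [IsDomain R] [IsNoetherianRing R] [IsIntegrallyClosed R]
  {X : Type v} [AddCommGroup X] [Module R X]
  {XS : Type w} [AddCommGroup XS] [Module R XS]

/-- **Σ-removal first, then `μ` of the primitive `L` (Fouquet–Wan 2021 App. B, last paragraph of the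
proof of Thm. 7.32; Wan 2015 Lemma 87 / Thm. 101).** Let `R` be a Noetherian normal domain, `X`
(«`X_ac(E[p^∞]) ⊗ Λ^{ur}`», primitive) and `XS` («`X^Σ`», Σ-relaxed) `R`-modules (finite torsion in the
application; the bookkeeping below needs neither), `L`
(«`𝓛`», primitive) and `E` («`∏_{v ∈ Σ∖p} E_v`», the removed Euler factors) non-zero, and Pb a set
of height-one primes («pulled back from `𝕀⟦Γ⁺⟧`»). Assume (hGV) `char(XS) = char(X)·(E)`
[Greenberg–Vatsal: the same Euler factors on the algebraic side], (hDiv) at every height-one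
`𝔭 ∉ Pb` the divisibility of the Σ-DEPLETED objects, `char(XS)·R_𝔭 ⊆ (L·E)·R_𝔭` [the
Eisenstein-congruence machine away from Pb], and (hμ) `L ∉ 𝔭` for every `𝔭 ∈ Pb` [`μ = 0` of the
PRIMITIVE anticyclotomic `L`-function on the line through `φ₀` ⇒ `𝓛` lies in no pulled-back
prime]. Then `char(X) ⊆ (L)` — the FULL one-sided divisibility, with no statement about the
`μ`-invariant of the Σ-depleted `L·E` ever needed. Proof: at `𝔭 ∉ Pb` cancel the non-zero `E` in
the domain `R_𝔭`; at `𝔭 ∈ Pb`, `L` is a unit of `R_𝔭`; conclude by Krull's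
`(L) = ⋂_{ht 𝔭 = 1} L·R_𝔭` (Matsumura 11.5 (ii)). [cite: FouquetWan2021, App. B, proof of Thm. 7.32 (last paragraph)]
[cite: Wan2015HilbertIMC, Lemma 87 and Thm. 101] [cite: Matsumura1987, Thm. 11.5 (ii) (p. 82)] -/
theorem charIdeal_le_span_singleton_of_imprimitive_reordering
    {L E : R} (hL : L ≠ 0) (hE : E ≠ 0)
    (Pb : Set (PrimeSpectrum R))
    (hGV : charIdeal R XS = charIdeal R X * Ideal.span {E})
    (hDiv : ∀ 𝔭 : PrimeSpectrum R, 𝔭.asIdeal.height = 1 → 𝔭 ∉ Pb →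
      (charIdeal R XS).map (algebraMap R (Localization.AtPrime 𝔭.asIdeal)) ≤
        (Ideal.span {L * E}).map (algebraMap R (Localization.AtPrime 𝔭.asIdeal)))
    (hμ : ∀ 𝔭 ∈ Pb, L ∉ 𝔭.asIdeal) :
    charIdeal R X ≤ Ideal.span {L} := by
  intro y hy
  refine mem_span_singleton_of_forall_height_eq_one hL fun P hP hP1 => ?_
  let 𝔭 : PrimeSpectrum R := ⟨P, hP⟩
  -- it suffices to compare the two ideals in the localisation `R_𝔭`
  suffices hle : (charIdeal R X).map (algebraMap R (Localization.AtPrime 𝔭.asIdeal)) ≤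
      (Ideal.span {L}).map (algebraMap R (Localization.AtPrime 𝔭.asIdeal)) by
    obtain ⟨m, hm, hmx⟩ :=
      (IsLocalization.algebraMap_mem_map_algebraMap_iff 𝔭.asIdeal.primeCompl
        (Localization.AtPrime 𝔭.asIdeal) (Ideal.span {L}) y).mp (hle (Ideal.mem_map_of_mem _ hy))
    exact ⟨m, hm, hmx⟩
  by_cases hPb : 𝔭 ∈ Pb
  · -- at a pulled-back prime, `L` is a unit of `R_𝔭`
    have hunit : IsUnit (algebraMap R (Localization.AtPrime 𝔭.asIdeal) L) :=
      IsLocalization.map_units _ ⟨L, show L ∈ 𝔭.asIdeal.primeCompl from hμ 𝔭 hPb⟩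
    have htop : (Ideal.span {L}).map (algebraMap R (Localization.AtPrime 𝔭.asIdeal)) = ⊤ := by
      rw [Ideal.map_span, Set.image_singleton, Ideal.span_singleton_eq_top]
      exact hunit
    rw [htop]
    exact le_top
  · -- away from Pb: cancel the Euler factor `E` in the domain `R_𝔭`
    have hE' : algebraMap R (Localization.AtPrime 𝔭.asIdeal) E ≠ 0 :=
      IsLocalization.to_map_ne_zero_of_mem_nonZeroDivisors _ 𝔭.asIdeal.primeCompl_le_nonZeroDivisors
        (mem_nonZeroDivisors_of_ne_zero hE)
    have h := hDiv 𝔭 hP1 hPb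
    rw [hGV, Ideal.map_mul, Ideal.map_span, Set.image_singleton, ← Ideal.span_singleton_mul_span_singleton,
      Ideal.map_mul, Ideal.map_span, Ideal.map_span, Set.image_singleton, Set.image_singleton,
      mul_comm (Ideal.map _ (charIdeal R X)), mul_comm (Ideal.span {algebraMap R _ L})] at h
    rw [Ideal.map_span, Set.image_singleton]
    exact (Ideal.span_singleton_mul_right_mono hE').mp h

end Summit.BirchSwinnertonDyer.Rank1Residual.X11b.ImprimitiveReordering

end
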